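import Summits.AtomisticToContinuum.HydrodynamicLimit.Theorems.TwoClocksEquilibriumFastWindowLDNormalFormEquivalence
import Summits.AtomisticToContinuum.HydrodynamicLimit.Theorems.TwoClocksEquilibriumFastWindowLDNormalFormConverse
import Summits.AtomisticToContinuum.HydrodynamicLimit.Theorems.TwoClocksEquilibriumFastWindowLDReductionEntropy

/-!
# The three currencies of `EquilibriumFastWindowLD` are equivalent
(crux stmt-AtomisticToContinuum-14440 `TwoClocks.EquilibriumFastWindowLD`, line `Sketch`; lead c4)

Helper file (`--supports stmt-AtomisticToContinuum-14440`) recording, as `Iff`s, the closed circle of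
implications around the crux produced by the line `Sketch`:

* `W` — the crux restricted to the bounded class `𝒢(C')` (continuous `G`, `|G(x,v)| ≤ C'(1+|v|²)`,
  compact `v`-support, `M_{1,u₀,θ₀}`-orthogonal at every `x` to `1, v_j, |v|²`) with a
  class-uniform tilt range `β₁(C')`;
* `P` — the perturbative entropy normal form (= the line's one open registered stub
  `stub_perturbativeRelaxation`): entropy-linear relaxation of time-averaged fast one-body means for
  small-entropy perturbations of the global Gibbs state.

`W → crux` (`EquilibriumFastWindowLD_of_boundedWindowLD`, p125773: tails, truncation, Hölder),
`crux → W` (`boundedWindowLD_of_EquilibriumFastWindowLD`, this line lead c4: automatic uniformity by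
Baire category + window quasi-monotonicity), `P → W` (`stub_tiltDuality`, p127451: Gibbs variational
identity), `W → P` (`perturbativeRelaxation_of_boundedWindowLD`, p127561: Donsker–Varadhan):

* `boundedWindowLD_iff_EquilibriumFastWindowLD : W ↔ EquilibriumFastWindowLD`;
* `perturbativeRelaxation_iff_EquilibriumFastWindowLD : P ↔ EquilibriumFastWindowLD`.

Consequently the line `Sketch` (static seed + doubling RG, bounded normal form, entropy duality)
reduces the crux EXACTLY to itself: every static step is kernel-checked and what remains —
uniform-in-`N` kinetic relaxation of the hard-sphere fluid at fixed small volume fraction over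
`τσ²√θ₀` mean free times at large-deviation scale — is the whole crux, in whichever of the three
currencies one prefers to attack it.
-/

noncomputable section

open MeasureTheory ProbabilityTheory Real Set Filter InformationTheory
open scoped ENNReal BigOperators

namespace Summit.AtomisticToContinuum.HydrodynamicLimit.Theorems.FastWindowRG

open Literature.Analysis.FluidPDE Literature.MathematicalPhysics.KineticTheory

/-- **`W ⟺ crux`**: the bounded-class window LD with class-uniform tilt range is equivalent to
`EquilibriumFastWindowLD`. -/
theorem boundedWindowLD_iff_EquilibriumFastWindowLD :
    (∃ σ₀ : ℝ, 0 < σ₀ ∧ ∀ (a₀ θ₀ : ℝ) (u₀ : V3), 0 < a₀ → 0 < θ₀ → ∀ σ : ℝ, 0 < σ → σ < σ₀ →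
      ∀ Φ : (N : ℕ) → HardSphereFlow (Torus.geometry (Fin 3)) (hsDiameter σ N) (N + 1),
      ∀ C' : ℝ, 0 ≤ C' → ∃ β₁ : ℝ, 0 < β₁ ∧
      ∀ G : T3 × V3 → ℝ, Continuous G → (∀ y, |G y| ≤ C' * (1 + ‖y.2‖ ^ 2)) →
      (∃ R : ℝ, ∀ y : T3 × V3, R ≤ ‖y.2‖ → G y = 0) →
      (∀ x, ∫ v, G (x, v) * localMaxwellian 1 θ₀ u₀ v = 0) →
      (∀ x (j : Fin 3), ∫ v, G (x, v) * v j * localMaxwellian 1 θ₀ u₀ v = 0) →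
      (∀ x, ∫ v, G (x, v) * ‖v‖ ^ 2 * localMaxwellian 1 θ₀ u₀ v = 0) →
      ∀ β : ℝ, |β| ≤ β₁ → ∀ ε : ℝ, 0 < ε → ∃ τ : ℝ, 0 < τ ∧ ∃ N₀ : ℕ, ∀ N : ℕ, N₀ ≤ N →
        ∫⁻ z, ENNReal.ofReal (Real.exp (β * ∑ i : Fin (N + 1),
            (τ * ((N : ℝ) + 1) ^ (-(1 / 3 : ℝ)))⁻¹ *
              ∫ r in (0 : ℝ)..(τ * ((N : ℝ) + 1) ^ (-(1 / 3 : ℝ))), G (((Φ N).flow r z) i)))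
          ∂(localGibbsLaw σ (fun _ => a₀) (fun _ => u₀) (fun _ => θ₀) N (Φ N)) ≤
          ENNReal.ofReal (Real.exp (ε * ((N : ℝ) + 1)))) ↔
    Summit.AtomisticToContinuum.HydrodynamicLimit.Theses.TwoClocks.EquilibriumFastWindowLD :=
  ⟨EquilibriumFastWindowLD_of_boundedWindowLD, boundedWindowLD_of_EquilibriumFastWindowLD⟩

/-- **`P ⟺ crux`**: the perturbative entropy normal form (the registered open stub
`stub_perturbativeRelaxation` of the line `Sketch`, verbatim) is equivalent to
`EquilibriumFastWindowLD`. -/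
theorem perturbativeRelaxation_iff_EquilibriumFastWindowLD :
    (∃ σ₀ : ℝ, 0 < σ₀ ∧ ∀ (a₀ θ₀ : ℝ) (u₀ : V3), 0 < a₀ → 0 < θ₀ → ∀ σ : ℝ, 0 < σ → σ < σ₀ →
      ∀ Φ : (N : ℕ) → HardSphereFlow (Torus.geometry (Fin 3)) (hsDiameter σ N) (N + 1),
      ∀ C' : ℝ, 0 ≤ C' → ∃ β₁ : ℝ, 0 < β₁ ∧ ∃ s₀ : ℝ, 0 < s₀ ∧
      ∀ G : T3 × V3 → ℝ, Continuous G → (∀ y, |G y| ≤ C' * (1 + ‖y.2‖ ^ 2)) →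
      (∃ R : ℝ, ∀ y : T3 × V3, R ≤ ‖y.2‖ → G y = 0) →
      (∀ x, ∫ v, G (x, v) * localMaxwellian 1 θ₀ u₀ v = 0) →
      (∀ x (j : Fin 3), ∫ v, G (x, v) * v j * localMaxwellian 1 θ₀ u₀ v = 0) →
      (∀ x, ∫ v, G (x, v) * ‖v‖ ^ 2 * localMaxwellian 1 θ₀ u₀ v = 0) →
      ∀ ε : ℝ, 0 < ε → ∃ τ : ℝ, 0 < τ ∧ ∃ N₀ : ℕ, ∀ N : ℕ, N₀ ≤ N →
        ∀ Q : Measure (Config (N + 1) (Fin 3) T3), IsProbabilityMeasure Q →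
          Q ≪ localGibbsLaw σ (fun _ => a₀) (fun _ => u₀) (fun _ => θ₀) N (Φ N) →
          klDiv Q (localGibbsLaw σ (fun _ => a₀) (fun _ => u₀) (fun _ => θ₀) N (Φ N)) ≤
            ENNReal.ofReal (s₀ * ((N : ℝ) + 1)) →
          β₁ * ∫ z, (∑ i : Fin (N + 1), (τ * ((N : ℝ) + 1) ^ (-(1 / 3 : ℝ)))⁻¹ *
              ∫ r in (0 : ℝ)..(τ * ((N : ℝ) + 1) ^ (-(1 / 3 : ℝ))), G (((Φ N).flow r z) i)) ∂Q ≤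
            (klDiv Q (localGibbsLaw σ (fun _ => a₀) (fun _ => u₀) (fun _ => θ₀) N (Φ N))).toReal +
              ε * ((N : ℝ) + 1)) ↔
    Summit.AtomisticToContinuum.HydrodynamicLimit.Theses.TwoClocks.EquilibriumFastWindowLD :=
  ⟨EquilibriumFastWindowLD_of_perturbativeRelaxation, fun h =>
    perturbativeRelaxation_of_boundedWindowLD (boundedWindowLD_of_EquilibriumFastWindowLD h)⟩

end Summit.AtomisticToContinuum.HydrodynamicLimit.Theorems.FastWindowRG

end
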